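import Summits.PneNP.PneNP.Theorems.KarlinRubinMonotoneBlindDepth3Avg

/-!
# Route KarlinRubin, crux `MonotoneBlind` (stmt-PneNP-18027): depth 3 — the rescue lemma for one CNF

Assembly of the per-CNF bound of the depth-3 line (seat write-up `MonotoneBlind_depth3_theorem.md`): for a clause
family `𝓒` with `#𝓒 ≤ n^c`, threshold `t ≥ m'·r - r` with `r = C(v₀-1,2) < m'`, and the numeric hypotheses
`H1`–`H6` (all true eventually for `k = ⌈n^{1/2-δ}⌉`, `v₀ > (4c+4)/(1+2δ)`, `L' ≍ log n`, `M > (c+1)/δ`), the average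
over the planted set `A` of `Pr_x[H_t(𝓒, A, x)]` — the CNF accepts `plant A x` but every transversal inside it has
`> t` slots inside `A` — is at most `(2^{m' r + 1} + 3) · (n^{c+2})⁻¹`.

* `depth3_prob_H_le` — per planted set: `Pr[H_t] ≤ 2^{m'r} Pr[E'] + Σ_{big S} Pr[S needs rescue] + [Bad₂(A)]`;
* `depth3_avg_white_parts_le` — avg of `E'` is `≤ #𝓒 2⁻¹^{2L'} + 2 (2L'd)^{v₀}/n^{v₀}` (big off clause, or encoding);
* `depth3_avg_H_le` — the rescue lemma.

All `--supports stmt-PneNP-18027`; no definitions.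
-/

set_option linter.dupNamespace false -- `Summit.PneNP.PneNP.…`: summit = sub-problem (D-0017)

namespace Summit.PneNP.PneNP.Theorems

open Finset
open scoped ENNReal
open Literature.Computability.Complexity
open Literature.Probability.RandomGraphs.PlantedClique

variable {n : ℕ}

/-! ### Per planted set -/

open Classical in
/-- **`H_t` per planted set.** With `r = C(v₀-1,2)` and `m' r ≤ t + r`: `Pr_x[H_t(𝓒,A,x)]` is at most `2^{m' r}` times
`Pr_x[E'(A,x)]` (resampling, on the structure event), plus the probability that some big clause (`≥ 2L'` slots) needs
rescue, plus the indicator that some small clause meets `A` in `≥ v₀` vertices (`depth3_bad_split`). [folklore] -/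
theorem depth3_prob_H_le (A : Finset (Fin n)) (𝓒 : Finset (Finset (⊤ : SimpleGraph (Fin n)).edgeSet))
    (t L' v₀ m' : ℕ) (hmr : m' * ((v₀ - 1).choose 2) ≤ t + (v₀ - 1).choose 2) :
    (erdosRenyiHalf n).toOuterMeasure {x |
        (∀ S ∈ 𝓒, ∃ e ∈ S, plant A x e = true) ∧
          ∀ T : Finset (⊤ : SimpleGraph (Fin n)).edgeSet, (∀ S ∈ 𝓒, ∃ e ∈ S, e ∈ T) →
            (∀ e ∈ T, plant A x e = true) →
              t < #(T.filter fun e : (⊤ : SimpleGraph (Fin n)).edgeSet => ∀ v ∈ (e : Sym2 (Fin n)), v ∈ A)} ≤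
      2 ^ (m' * ((v₀ - 1).choose 2)) * (erdosRenyiHalf n).toOuterMeasure {x |
        (∀ S ∈ 𝓒, ∃ e ∈ S, plant A x e = true) ∧
          ∃ 𝓕 : Finset (Finset (⊤ : SimpleGraph (Fin n)).edgeSet), 𝓕 ⊆ 𝓒 ∧ #𝓕 = m' ∧
            (∀ S ∈ 𝓕, ∀ e ∈ S, x e = false) ∧
            ∀ S ∈ 𝓕, ∀ S' ∈ 𝓕, S ≠ S' →
              Disjoint (S.filter fun e : (⊤ : SimpleGraph (Fin n)).edgeSet => ∀ v ∈ (e : Sym2 (Fin n)), v ∈ A)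
                (S'.filter fun e : (⊤ : SimpleGraph (Fin n)).edgeSet => ∀ v ∈ (e : Sym2 (Fin n)), v ∈ A)} +
      ∑ S ∈ 𝓒.filter (fun S => 2 * L' ≤ #S), (erdosRenyiHalf n).toOuterMeasure
        {x | ∀ e ∈ S, (¬ ∀ v ∈ (e : Sym2 (Fin n)), v ∈ A) → x e = false} +
      (if ∃ S ∈ 𝓒, #S < 2 * L' ∧ v₀ ≤ #(A ∩ univ.filter fun v : Fin n => ∃ e ∈ S, v ∈ (e : Sym2 (Fin n)))
        then 1 else 0) := by
  classical
  set r := (v₀ - 1).choose 2 with hr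
  set P0 := erdosRenyiHalf n with hP0
  set ins : Finset (⊤ : SimpleGraph (Fin n)).edgeSet → Finset (⊤ : SimpleGraph (Fin n)).edgeSet :=
    fun S => S.filter fun e : (⊤ : SimpleGraph (Fin n)).edgeSet => ∀ v ∈ (e : Sym2 (Fin n)), v ∈ A with hins
  -- the events
  set Hp : EdgeVec n → Prop := fun x =>
    (∀ S ∈ 𝓒, ∃ e ∈ S, plant A x e = true) ∧
      ∀ T : Finset (⊤ : SimpleGraph (Fin n)).edgeSet, (∀ S ∈ 𝓒, ∃ e ∈ S, e ∈ T) →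
        (∀ e ∈ T, plant A x e = true) → t < #(ins T) with hHp
  set Gp : EdgeVec n → Prop := fun x =>
    ∀ S ∈ 𝓒, (∀ e ∈ S, (¬ ∀ v ∈ (e : Sym2 (Fin n)), v ∈ A) → x e = false) → #(ins S) ≤ r with hGp
  set Ep : EdgeVec n → Prop := fun x =>
    (∀ S ∈ 𝓒, ∃ e ∈ S, plant A x e = true) ∧
      ∃ 𝓕 : Finset (Finset (⊤ : SimpleGraph (Fin n)).edgeSet), 𝓕 ⊆ 𝓒 ∧ #𝓕 = m' ∧
        (∀ S ∈ 𝓕, ∀ e ∈ S, x e = false) ∧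
        ∀ S ∈ 𝓕, ∀ S' ∈ 𝓕, S ≠ S' → Disjoint (ins S) (ins S') with hEp
  set B1 : EdgeVec n → Prop := fun x =>
    ∃ S ∈ 𝓒.filter (fun S => 2 * L' ≤ #S), ∀ e ∈ S, (¬ ∀ v ∈ (e : Sym2 (Fin n)), v ∈ A) → x e = false with hB1
  set Q : Prop := ∃ S ∈ 𝓒, #S < 2 * L' ∧
    v₀ ≤ #(A ∩ univ.filter fun v : Fin n => ∃ e ∈ S, v ∈ (e : Sym2 (Fin n))) with hQ
  change P0.toOuterMeasure {x | Hp x} ≤ 2 ^ (m' * r) * P0.toOuterMeasure {x | Ep x} +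
    ∑ S ∈ 𝓒.filter (fun S => 2 * L' ≤ #S), P0.toOuterMeasure
      {x | ∀ e ∈ S, (¬ ∀ v ∈ (e : Sym2 (Fin n)), v ∈ A) → x e = false} + (if Q then 1 else 0)
  -- the cover
  have hcover : {x | Hp x} ⊆ {x | Hp x ∧ Gp x} ∪
      (⋃ S ∈ 𝓒.filter (fun S => 2 * L' ≤ #S), {x | ∀ e ∈ S, (¬ ∀ v ∈ (e : Sym2 (Fin n)), v ∈ A) → x e = false}) ∪
        {_x | Q} := by
    intro x hx
    simp only [Set.mem_setOf_eq] at hx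
    by_cases hG : Gp x
    · exact Or.inl (Or.inl ⟨hx, hG⟩)
    · -- some clause needing rescue has a big inside part
      have hbad : ∃ S ∈ 𝓒, (∀ e ∈ S, (¬ ∀ v ∈ (e : Sym2 (Fin n)), v ∈ A) → x e = false) ∧ r < #(ins S) := by
        by_contra h
        refine hG fun S hS hresc => ?_
        by_contra hlt
        exact h ⟨S, hS, hresc, not_le.1 hlt⟩
      obtain ⟨S, hS, hresc, hlt⟩ := hbad
      rcases depth3_bad_split A S L' v₀ (by rw [← hr]; exact hlt) with hbig | ⟨hsmall, hv⟩
      · refine Or.inl (Or.inr ?_)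
        simp only [Set.mem_iUnion, Set.mem_setOf_eq]
        exact ⟨S, mem_filter.2 ⟨hS, hbig⟩, hresc⟩
      · exact Or.inr ⟨S, hS, hsmall, hv⟩
  -- resampling on the structure event
  have hres : P0.toOuterMeasure {x | Hp x ∧ Gp x} ≤ 2 ^ (m' * r) * P0.toOuterMeasure {x | Ep x} := by
    have hcount := depth3_resample_count A 𝓒 t r m' hmr
    have h := erdosRenyiHalf_le_mul_of_card_le {x | Hp x ∧ Gp x} {x | Ep x} (2 ^ (m' * r))
      (by simpa only [Set.mem_setOf_eq] using hcount)
    rw [hP0]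
    convert h using 2
    push_cast
    rfl
  calc P0.toOuterMeasure {x | Hp x}
      ≤ P0.toOuterMeasure ({x | Hp x ∧ Gp x} ∪
          (⋃ S ∈ 𝓒.filter (fun S => 2 * L' ≤ #S),
            {x | ∀ e ∈ S, (¬ ∀ v ∈ (e : Sym2 (Fin n)), v ∈ A) → x e = false}) ∪ {_x | Q}) :=
        P0.toOuterMeasure.mono hcover
    _ ≤ P0.toOuterMeasure {x | Hp x ∧ Gp x} +
          P0.toOuterMeasure (⋃ S ∈ 𝓒.filter (fun S => 2 * L' ≤ #S),
            {x | ∀ e ∈ S, (¬ ∀ v ∈ (e : Sym2 (Fin n)), v ∈ A) → x e = false}) +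
          P0.toOuterMeasure {_x | Q} :=
        (MeasureTheory.measure_union_le _ _).trans (add_le_add (MeasureTheory.measure_union_le _ _) le_rfl)
    _ ≤ 2 ^ (m' * r) * P0.toOuterMeasure {x | Ep x} +
          ∑ S ∈ 𝓒.filter (fun S => 2 * L' ≤ #S), P0.toOuterMeasure
            {x | ∀ e ∈ S, (¬ ∀ v ∈ (e : Sym2 (Fin n)), v ∈ A) → x e = false} + (if Q then 1 else 0) :=
        add_le_add (add_le_add hres (MeasureTheory.measure_biUnion_finset_le _ _))
          (erdosRenyiHalf_toOuterMeasure_const_le Q)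

/-! ### The average of `E'` -/

open Classical in
/-- **The white-parts event, averaged.** With `C(v₀-1,2) < m'`, `1 ≤ L'`, `2·(2L'·d) ≤ n`: the average over `A` of
`Pr_x[E'(A,x)]` is at most `#𝓒 · 2⁻¹^{2L'}` (some clause with `≥ 2L'` slots is entirely off) plus
`2 (2L' d)^{v₀} / n^{v₀}` (otherwise `A` contains a minimal touching set of size `≥ v₀` of the off-clause family, whose
clauses have `< 2L'` slots: Fubini and the encoding bound). [folklore] -/
theorem depth3_avg_white_parts_le (hn : 0 < n) (k : ℕ) (𝓒 : Finset (Finset (⊤ : SimpleGraph (Fin n)).edgeSet))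
    {L' v₀ m' : ℕ} (hm' : (v₀ - 1).choose 2 < m') (hL' : 1 ≤ L') (hsmall : 2 * (2 * L' * min k n) ≤ n) :
    ((#(kSubsets n k) : ℕ) : ℝ≥0∞)⁻¹ * ∑ A ∈ kSubsets n k, (erdosRenyiHalf n).toOuterMeasure {x |
        (∀ S ∈ 𝓒, ∃ e ∈ S, plant A x e = true) ∧
          ∃ 𝓕 : Finset (Finset (⊤ : SimpleGraph (Fin n)).edgeSet), 𝓕 ⊆ 𝓒 ∧ #𝓕 = m' ∧
            (∀ S ∈ 𝓕, ∀ e ∈ S, x e = false) ∧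
            ∀ S ∈ 𝓕, ∀ S' ∈ 𝓕, S ≠ S' →
              Disjoint (S.filter fun e : (⊤ : SimpleGraph (Fin n)).edgeSet => ∀ v ∈ (e : Sym2 (Fin n)), v ∈ A)
                (S'.filter fun e : (⊤ : SimpleGraph (Fin n)).edgeSet => ∀ v ∈ (e : Sym2 (Fin n)), v ∈ A)} ≤
      (#𝓒 : ℝ≥0∞) * (2⁻¹ : ℝ≥0∞) ^ (2 * L') +
        2 * ((((2 * L' * min k n) ^ v₀ : ℕ) : ℝ≥0∞) / ((n ^ v₀ : ℕ) : ℝ≥0∞)) := by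
  classical
  set KS := kSubsets n k with hKS
  set P0 := erdosRenyiHalf n with hP0
  have hne := card_kSubsets_cast_ne_zero n k
  have htop : ((#KS : ℕ) : ℝ≥0∞) ≠ ⊤ := ENNReal.natCast_ne_top _
  -- the events
  set Ep : Finset (Fin n) → EdgeVec n → Prop := fun A x =>
    (∀ S ∈ 𝓒, ∃ e ∈ S, plant A x e = true) ∧
      ∃ 𝓕 : Finset (Finset (⊤ : SimpleGraph (Fin n)).edgeSet), 𝓕 ⊆ 𝓒 ∧ #𝓕 = m' ∧
        (∀ S ∈ 𝓕, ∀ e ∈ S, x e = false) ∧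
        ∀ S ∈ 𝓕, ∀ S' ∈ 𝓕, S ≠ S' →
          Disjoint (S.filter fun e : (⊤ : SimpleGraph (Fin n)).edgeSet => ∀ v ∈ (e : Sym2 (Fin n)), v ∈ A)
            (S'.filter fun e : (⊤ : SimpleGraph (Fin n)).edgeSet => ∀ v ∈ (e : Sym2 (Fin n)), v ∈ A) with hEp
  set B3 : EdgeVec n → Prop := fun x => ∃ S ∈ 𝓒.filter (fun S => 2 * L' ≤ #S), ∀ e ∈ S, x e = false with hB3
  change ((#KS : ℕ) : ℝ≥0∞)⁻¹ * ∑ A ∈ KS, P0.toOuterMeasure {x | Ep A x} ≤ _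
  -- split off `B3`
  have hsplit : ∀ A, P0.toOuterMeasure {x | Ep A x} ≤
      P0.toOuterMeasure {x | B3 x} + P0.toOuterMeasure {x | Ep A x ∧ ¬ B3 x} := by
    intro A
    refine le_trans (P0.toOuterMeasure.mono fun x hx => ?_) (MeasureTheory.measure_union_le _ _)
    by_cases hb : B3 x
    · exact Or.inl hb
    · exact Or.inr ⟨hx, hb⟩
  -- `B3`
  have hB3le : P0.toOuterMeasure {x | B3 x} ≤ (#𝓒 : ℝ≥0∞) * (2⁻¹ : ℝ≥0∞) ^ (2 * L') := by
    have hcov : {x | B3 x} ⊆ ⋃ S ∈ 𝓒.filter (fun S => 2 * L' ≤ #S), {x : EdgeVec n | ∀ e ∈ S, x e = false} := by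
      intro x hx
      simp only [Set.mem_setOf_eq, hB3] at hx
      obtain ⟨S, hS, hoff⟩ := hx
      exact Set.mem_biUnion hS hoff
    calc P0.toOuterMeasure {x | B3 x}
        ≤ ∑ S ∈ 𝓒.filter (fun S => 2 * L' ≤ #S), P0.toOuterMeasure {x : EdgeVec n | ∀ e ∈ S, x e = false} :=
          (P0.toOuterMeasure.mono hcov).trans (MeasureTheory.measure_biUnion_finset_le _ _)
      _ ≤ ∑ _S ∈ 𝓒.filter (fun S => 2 * L' ≤ #S), (2⁻¹ : ℝ≥0∞) ^ (2 * L') :=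
          sum_le_sum fun S hS => depth3_prob_allOff_le S (mem_filter.1 hS).2
      _ = (#(𝓒.filter fun S => 2 * L' ≤ #S) : ℝ≥0∞) * (2⁻¹ : ℝ≥0∞) ^ (2 * L') := by
          rw [sum_const, nsmul_eq_mul]
      _ ≤ (#𝓒 : ℝ≥0∞) * (2⁻¹ : ℝ≥0∞) ^ (2 * L') := by
          gcongr; exact filter_subset _ _
  -- `Ep ∧ ¬ B3` via Fubini and the encoding bound
  have hEnc : ((#KS : ℕ) : ℝ≥0∞)⁻¹ * ∑ A ∈ KS, P0.toOuterMeasure {x | Ep A x ∧ ¬ B3 x} ≤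
      2 * ((((2 * L' * min k n) ^ v₀ : ℕ) : ℝ≥0∞) / ((n ^ v₀ : ℕ) : ℝ≥0∞)) := by
    refine depth3_avg_le_of_forall k (fun A x => Ep A x ∧ ¬ B3 x) _ fun x => ?_
    -- the white family of `x`
    set 𝒲 := 𝓒.filter (fun S => ∀ e ∈ S, x e = false) with h𝒲
    set τ : Finset (Fin n) → Prop := fun Z => ∀ S ∈ 𝒲, ∃ e ∈ S, ∀ v ∈ (e : Sym2 (Fin n)), v ∈ Z with hτ
    set 𝓜 : Finset (Finset (Fin n)) := univ.filter fun Z => τ Z ∧ ∀ v ∈ Z, ¬ τ (Z.erase v) with h𝓜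
    have h𝓜mem : ∀ Z, Z ∈ 𝓜 ↔ τ Z ∧ ∀ v ∈ Z, ¬ τ (Z.erase v) := fun Z => by
      rw [h𝓜, mem_filter]; exact ⟨fun h => h.2, fun h => ⟨mem_univ _, h⟩⟩
    by_cases hB : B3 x
    · -- the event is empty
      refine ⟨∅, fun A _ h => (h.2 hB).elim, ?_⟩
      rw [card_empty, Nat.cast_zero, mul_zero]
      exact bot_le
    · have hW : ∀ S ∈ 𝒲, #S ≤ 2 * L' := by
        intro S hS
        rw [h𝒲, mem_filter] at hS
        by_contra hlt
        exact hB ⟨S, mem_filter.2 ⟨hS.1, (not_le.1 hlt).le⟩, hS.2⟩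
      refine ⟨(kSubsets n k).filter fun A => ∃ Z ∈ 𝓜, v₀ ≤ #Z ∧ Z ⊆ A, fun A hAK hA => ?_,
        depth3_avg_encoding_le hn 𝒲 τ (fun Z => Iff.rfl) 𝓜 h𝓜mem (by omega) hW k v₀ hsmall⟩
      obtain ⟨⟨hsat, 𝓕, h𝓕𝓒, h𝓕card, h𝓕off, h𝓕disj⟩, -⟩ := hA
      exact mem_filter.2 ⟨hAK, depth3_exists_minimal_of_white_parts A 𝓒 x m' v₀ hm' τ (fun Z => Iff.rfl) 𝓜 h𝓜mem
        hsat 𝓕 h𝓕𝓒 h𝓕card h𝓕off h𝓕disj⟩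
  -- assemble
  calc ((#KS : ℕ) : ℝ≥0∞)⁻¹ * ∑ A ∈ KS, P0.toOuterMeasure {x | Ep A x}
      ≤ ((#KS : ℕ) : ℝ≥0∞)⁻¹ * ∑ A ∈ KS, (P0.toOuterMeasure {x | B3 x} + P0.toOuterMeasure {x | Ep A x ∧ ¬ B3 x}) := by
        gcongr with A _; exact hsplit A
    _ = P0.toOuterMeasure {x | B3 x} + ((#KS : ℕ) : ℝ≥0∞)⁻¹ * ∑ A ∈ KS, P0.toOuterMeasure {x | Ep A x ∧ ¬ B3 x} := by
        rw [sum_add_distrib, mul_add, sum_const, nsmul_eq_mul, ← mul_assoc, ENNReal.inv_mul_cancel hne htop, one_mul]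
    _ ≤ _ := add_le_add hB3le hEnc

/-! ### The rescue lemma -/

/-- `n^c · (n^{2c+2})⁻¹ = (n^{c+2})⁻¹` in `ℝ≥0∞` (`0 < n`). [folklore] -/
theorem natCast_pow_mul_inv_pow_two_mul_add_two (hn : 0 < n) (c : ℕ) :
    ((n ^ c : ℕ) : ℝ≥0∞) * (((n ^ (2 * c + 2) : ℕ) : ℝ≥0∞))⁻¹ = (((n ^ (c + 2) : ℕ) : ℝ≥0∞))⁻¹ := by
  have h0 : ((n ^ c : ℕ) : ℝ≥0∞) ≠ 0 := by exact_mod_cast (pow_pos hn c).ne'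
  have htop : ((n ^ c : ℕ) : ℝ≥0∞) ≠ ⊤ := ENNReal.natCast_ne_top _
  have hsplit : ((n ^ (2 * c + 2) : ℕ) : ℝ≥0∞) = ((n ^ c : ℕ) : ℝ≥0∞) * ((n ^ (c + 2) : ℕ) : ℝ≥0∞) := by
    rw [← Nat.cast_mul, ← pow_add]; congr 2; ring
  rw [hsplit, ENNReal.mul_inv (Or.inl h0) (Or.inl htop), ← mul_assoc, ENNReal.mul_inv_cancel h0 htop, one_mul]

open Classical in
/-- **The rescue lemma (depth 3, one CNF).** For a clause family `𝓒` with `#𝓒 ≤ n^c`, `r = C(v₀-1,2) < m'`,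
`m' r ≤ t + r`, `1 ≤ v₀`, `1 ≤ L'` and the numeric hypotheses `H1`–`H6` (`d = min k n`): the average over the planted
set `A` of `Pr_x[H_t(𝓒,A,x)]` is at most `(2^{m'r+1} + 3) · (n^{c+2})⁻¹`. [folklore] -/
theorem depth3_avg_H_le (hn : 0 < n) (k : ℕ) (𝓒 : Finset (Finset (⊤ : SimpleGraph (Fin n)).edgeSet))
    {c L' v₀ M m' t : ℕ} (h𝓒 : #𝓒 ≤ n ^ c) (hv₀ : 1 ≤ v₀) (hL' : 1 ≤ L') (hm' : (v₀ - 1).choose 2 < m')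
    (hmr : m' * ((v₀ - 1).choose 2) ≤ t + (v₀ - 1).choose 2)
    (H1 : n ^ (2 * c + 2) ≤ 2 ^ L') (H2 : M * M ≤ 2 * L') (H3 : 18 * (min k n * min k n) ≤ n)
    (H4 : (18 * (min k n * min k n)) ^ M * n ^ (2 * c + 2) ≤ n ^ M)
    (H5 : (4 * L' * min k n) ^ v₀ * n ^ (2 * c + 2) ≤ n ^ v₀) (H6 : 2 * (2 * L' * min k n) ≤ n) :
    ((#(kSubsets n k) : ℕ) : ℝ≥0∞)⁻¹ * ∑ A ∈ kSubsets n k, (erdosRenyiHalf n).toOuterMeasure {x |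
        (∀ S ∈ 𝓒, ∃ e ∈ S, plant A x e = true) ∧
          ∀ T : Finset (⊤ : SimpleGraph (Fin n)).edgeSet, (∀ S ∈ 𝓒, ∃ e ∈ S, e ∈ T) →
            (∀ e ∈ T, plant A x e = true) →
              t < #(T.filter fun e : (⊤ : SimpleGraph (Fin n)).edgeSet => ∀ v ∈ (e : Sym2 (Fin n)), v ∈ A)} ≤
      (2 ^ (m' * ((v₀ - 1).choose 2) + 1) + 3 : ℝ≥0∞) * (((n ^ (c + 2) : ℕ) : ℝ≥0∞))⁻¹ := by
  classical
  set KS := kSubsets n k with hKS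
  set P0 := erdosRenyiHalf n with hP0
  set d := min k n with hd
  set r := (v₀ - 1).choose 2 with hr
  set Bn : ℝ≥0∞ := (((n ^ (2 * c + 2) : ℕ) : ℝ≥0∞))⁻¹ with hBn
  have hne := card_kSubsets_cast_ne_zero n k
  have htop : ((#KS : ℕ) : ℝ≥0∞) ≠ ⊤ := ENNReal.natCast_ne_top _
  -- the three averaged pieces
  set avgE : ℝ≥0∞ := ((#KS : ℕ) : ℝ≥0∞)⁻¹ * ∑ A ∈ KS, P0.toOuterMeasure {x |
      (∀ S ∈ 𝓒, ∃ e ∈ S, plant A x e = true) ∧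
        ∃ 𝓕 : Finset (Finset (⊤ : SimpleGraph (Fin n)).edgeSet), 𝓕 ⊆ 𝓒 ∧ #𝓕 = m' ∧
          (∀ S ∈ 𝓕, ∀ e ∈ S, x e = false) ∧
          ∀ S ∈ 𝓕, ∀ S' ∈ 𝓕, S ≠ S' →
            Disjoint (S.filter fun e : (⊤ : SimpleGraph (Fin n)).edgeSet => ∀ v ∈ (e : Sym2 (Fin n)), v ∈ A)
              (S'.filter fun e : (⊤ : SimpleGraph (Fin n)).edgeSet => ∀ v ∈ (e : Sym2 (Fin n)), v ∈ A)} with havgE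
  set avgR : Finset (⊤ : SimpleGraph (Fin n)).edgeSet → ℝ≥0∞ := fun S =>
    ((#KS : ℕ) : ℝ≥0∞)⁻¹ * ∑ A ∈ KS, P0.toOuterMeasure
      {x | ∀ e ∈ S, (¬ ∀ v ∈ (e : Sym2 (Fin n)), v ∈ A) → x e = false} with havgR
  set avgQ : ℝ≥0∞ := ((#KS : ℕ) : ℝ≥0∞)⁻¹ * ∑ A ∈ KS,
    (if ∃ S ∈ 𝓒, #S < 2 * L' ∧ v₀ ≤ #(A ∩ univ.filter fun v : Fin n => ∃ e ∈ S, v ∈ (e : Sym2 (Fin n)))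
      then (1 : ℝ≥0∞) else 0) with havgQ
  -- numeric facts
  have hhalf : (2⁻¹ : ℝ≥0∞) ^ L' ≤ Bn := half_pow_le_inv_natCast H1
  have hhalf2 : (2⁻¹ : ℝ≥0∞) ^ (2 * L') ≤ Bn :=
    (pow_le_pow_right_of_le_one' (by norm_num) (by omega)).trans hhalf
  have hhalf1 : (2⁻¹ : ℝ≥0∞) ^ (L' + 1) ≤ Bn :=
    (pow_le_pow_right_of_le_one' (by norm_num) (by omega)).trans hhalf
  have hB5 : (((4 * L' * d) ^ v₀ : ℕ) : ℝ≥0∞) / ((n ^ v₀ : ℕ) : ℝ≥0∞) ≤ Bn :=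
    natCast_div_le_inv_of_mul_le H5 (pow_pos hn _).ne'
  have hB5' : 2 * ((((2 * L' * d) ^ v₀ : ℕ) : ℝ≥0∞) / ((n ^ v₀ : ℕ) : ℝ≥0∞)) ≤ Bn := by
    refine le_trans ?_ hB5
    rw [← mul_div_assoc]
    gcongr
    have : 2 * (2 * L' * d) ^ v₀ ≤ (4 * L' * d) ^ v₀ := by
      have h2 : 2 ≤ 2 ^ v₀ := by
        calc 2 = 2 ^ 1 := (pow_one 2).symm
          _ ≤ 2 ^ v₀ := Nat.pow_le_pow_right two_pos hv₀
      calc 2 * (2 * L' * d) ^ v₀ ≤ 2 ^ v₀ * (2 * L' * d) ^ v₀ := Nat.mul_le_mul_right _ h2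
        _ = (2 * (2 * L' * d)) ^ v₀ := (mul_pow 2 _ _).symm
        _ = (4 * L' * d) ^ v₀ := by ring
    exact_mod_cast this
  have h𝓒' : (#𝓒 : ℝ≥0∞) ≤ ((n ^ c : ℕ) : ℝ≥0∞) := by exact_mod_cast h𝓒
  have hone : (1 : ℝ≥0∞) ≤ ((n ^ c : ℕ) : ℝ≥0∞) := by exact_mod_cast Nat.one_le_pow c n hn
  -- bounds on the pieces
  have hE : avgE ≤ (#𝓒 : ℝ≥0∞) * (2⁻¹ : ℝ≥0∞) ^ (2 * L') +
      2 * ((((2 * L' * d) ^ v₀ : ℕ) : ℝ≥0∞) / ((n ^ v₀ : ℕ) : ℝ≥0∞)) :=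
    depth3_avg_white_parts_le hn k 𝓒 hm' hL' H6
  have hR : ∀ S ∈ 𝓒.filter (fun S => 2 * L' ≤ #S), avgR S ≤ Bn + (2⁻¹ : ℝ≥0∞) ^ (L' + 1) :=
    fun S hS => depth3_avg_rescue_big_le hn k S (mem_filter.1 hS).2 H2 H3 H4
  have hQ : avgQ ≤ (#𝓒 : ℝ≥0∞) * ((((4 * L' * d) ^ v₀ : ℕ) : ℝ≥0∞) / ((n ^ v₀ : ℕ) : ℝ≥0∞)) := by
    refine le_trans (avg_kSubsets_le_card_filter k _
      (fun A => ∃ S ∈ 𝓒, #S < 2 * L' ∧ v₀ ≤ #(A ∩ univ.filter fun v : Fin n => ∃ e ∈ S, v ∈ (e : Sym2 (Fin n))))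
      fun A _ => le_rfl) ?_
    exact depth3_avg_bad₂_le hn 𝓒 k L' v₀
  -- per-`A` bound, summed
  have hsum : ((#KS : ℕ) : ℝ≥0∞)⁻¹ * ∑ A ∈ KS, P0.toOuterMeasure {x |
      (∀ S ∈ 𝓒, ∃ e ∈ S, plant A x e = true) ∧
        ∀ T : Finset (⊤ : SimpleGraph (Fin n)).edgeSet, (∀ S ∈ 𝓒, ∃ e ∈ S, e ∈ T) →
          (∀ e ∈ T, plant A x e = true) →
            t < #(T.filter fun e : (⊤ : SimpleGraph (Fin n)).edgeSet => ∀ v ∈ (e : Sym2 (Fin n)), v ∈ A)} ≤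
      2 ^ (m' * r) * avgE + ∑ S ∈ 𝓒.filter (fun S => 2 * L' ≤ #S), avgR S + avgQ := by
    calc _ ≤ ((#KS : ℕ) : ℝ≥0∞)⁻¹ * ∑ A ∈ KS, (2 ^ (m' * r) * P0.toOuterMeasure {x |
            (∀ S ∈ 𝓒, ∃ e ∈ S, plant A x e = true) ∧
              ∃ 𝓕 : Finset (Finset (⊤ : SimpleGraph (Fin n)).edgeSet), 𝓕 ⊆ 𝓒 ∧ #𝓕 = m' ∧
                (∀ S ∈ 𝓕, ∀ e ∈ S, x e = false) ∧
                ∀ S ∈ 𝓕, ∀ S' ∈ 𝓕, S ≠ S' →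
                  Disjoint (S.filter fun e : (⊤ : SimpleGraph (Fin n)).edgeSet => ∀ v ∈ (e : Sym2 (Fin n)), v ∈ A)
                    (S'.filter fun e : (⊤ : SimpleGraph (Fin n)).edgeSet => ∀ v ∈ (e : Sym2 (Fin n)), v ∈ A)} +
          ∑ S ∈ 𝓒.filter (fun S => 2 * L' ≤ #S), P0.toOuterMeasure
            {x | ∀ e ∈ S, (¬ ∀ v ∈ (e : Sym2 (Fin n)), v ∈ A) → x e = false} +
          (if ∃ S ∈ 𝓒, #S < 2 * L' ∧ v₀ ≤ #(A ∩ univ.filter fun v : Fin n => ∃ e ∈ S, v ∈ (e : Sym2 (Fin n)))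
            then (1 : ℝ≥0∞) else 0)) := by
          gcongr with A _
          exact depth3_prob_H_le A 𝓒 t L' v₀ m' hmr
      _ = 2 ^ (m' * r) * avgE + ∑ S ∈ 𝓒.filter (fun S => 2 * L' ≤ #S), avgR S + avgQ := by
          rw [sum_add_distrib, sum_add_distrib, mul_add, mul_add, havgE, havgQ, havgR]
          congr 1
          congr 1
          · rw [← mul_sum, mul_left_comm]
          · rw [sum_comm, mul_sum]
  -- numerics
  refine hsum.trans ?_
  have hkey := natCast_pow_mul_inv_pow_two_mul_add_two hn c
  calc 2 ^ (m' * r) * avgE + ∑ S ∈ 𝓒.filter (fun S => 2 * L' ≤ #S), avgR S + avgQ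
      ≤ 2 ^ (m' * r) * ((#𝓒 : ℝ≥0∞) * Bn + Bn) + ∑ _S ∈ 𝓒.filter (fun S => 2 * L' ≤ #S), (Bn + Bn) +
          (#𝓒 : ℝ≥0∞) * Bn := by
        gcongr 2 ^ (m' * r) * ?_ + ?_ + ?_
        · exact hE.trans (add_le_add (mul_le_mul' le_rfl hhalf2) hB5')
        · exact sum_le_sum fun S hS => (hR S hS).trans (add_le_add le_rfl hhalf1)
        · exact hQ.trans (mul_le_mul' le_rfl hB5)
    _ = 2 ^ (m' * r) * ((#𝓒 : ℝ≥0∞) * Bn + Bn) + (#(𝓒.filter fun S => 2 * L' ≤ #S) : ℝ≥0∞) * (Bn + Bn) +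
          (#𝓒 : ℝ≥0∞) * Bn := by rw [sum_const, nsmul_eq_mul]
    _ ≤ 2 ^ (m' * r) * (((n ^ c : ℕ) : ℝ≥0∞) * Bn + ((n ^ c : ℕ) : ℝ≥0∞) * Bn) +
          ((n ^ c : ℕ) : ℝ≥0∞) * (Bn + Bn) + ((n ^ c : ℕ) : ℝ≥0∞) * Bn := by
        have hfil : (#(𝓒.filter fun S => 2 * L' ≤ #S) : ℝ≥0∞) ≤ ((n ^ c : ℕ) : ℝ≥0∞) :=
          le_trans (by exact_mod_cast card_le_card (filter_subset _ _)) h𝓒'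
        gcongr
        · calc Bn = 1 * Bn := (one_mul _).symm
            _ ≤ ((n ^ c : ℕ) : ℝ≥0∞) * Bn := mul_le_mul' hone le_rfl
    _ = (2 ^ (m' * r + 1) + 3) * (((n ^ c : ℕ) : ℝ≥0∞) * Bn) := by rw [pow_succ]; ring
    _ = (2 ^ (m' * r + 1) + 3) * (((n ^ (c + 2) : ℕ) : ℝ≥0∞))⁻¹ := by rw [hBn, hkey]

/-! ### Registered form -/

/-- **stub_depth3Rescue** (registered side result of stmt-PneNP-18027, depth-3 line of seat 0; NOT a stub of the
picked line's composition). [folklore] -/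
theorem stub_depth3Rescue : ∀ (n : ℕ), 0 < n → ∀ (k : ℕ) (𝓒 : Finset (Finset ((⊤ : SimpleGraph (Fin n)).edgeSet))) (c L' v₀ M m' t : ℕ), 𝓒.card ≤ n ^ c → 1 ≤ v₀ → 1 ≤ L' → (v₀ - 1).choose 2 < m' → m' * ((v₀ - 1).choose 2) ≤ t + (v₀ - 1).choose 2 → n ^ (2 * c + 2) ≤ 2 ^ L' → M * M ≤ 2 * L' → 18 * (min k n * min k n) ≤ n → (18 * (min k n * min k n)) ^ M * n ^ (2 * c + 2) ≤ n ^ M → (4 * L' * min k n) ^ v₀ * n ^ (2 * c + 2) ≤ n ^ v₀ → 2 * (2 * L' * min k n) ≤ n → ((kSubsets n k).card : ℝ≥0∞)⁻¹ * ∑ A ∈ kSubsets n k, (erdosRenyiHalf n).toOuterMeasure {x | (∀ S ∈ 𝓒, ∃ e ∈ S, plant A x e = true) ∧ ∀ T : Finset ((⊤ : SimpleGraph (Fin n)).edgeSet), (∀ S ∈ 𝓒, ∃ e ∈ S, e ∈ T) → (∀ e ∈ T, plant A x e = true) → t < (T.filter fun e : ((⊤ : SimpleGraph (Fin n)).edgeSet)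 => ∀ v ∈ (e : Sym2 (Fin n)), v ∈ A).card} ≤ (2 ^ (m' * ((v₀ - 1).choose 2) + 1) + 3 : ℝ≥0∞) * (((n ^ (c + 2) : ℕ) : ℝ≥0∞))⁻¹ :=
  fun _ hn k 𝓒 _ _ _ _ _ _ h𝓒 hv₀ hL' hm' hmr H1 H2 H3 H4 H5 H6 =>
    depth3_avg_H_le hn k 𝓒 h𝓒 hv₀ hL' hm' hmr H1 H2 H3 H4 H5 H6

end Summit.PneNP.PneNP.Theorems
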